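import Summits.ABC.IUTFork.LDHSlotResiduePointPair
import Summits.ABC.ABC.Theorems.IUTThetaPilotThetaPartIIStubThetaData
import Literature.IUT.LogVolume.WeightDescent
import Literature.IUT.LogVolume.DifferentConductorTower
import Literature.IUT.LogVolume.DistinguishedPrimesBound
import Literature.IUT.LogVolume.LambdaLineGalois
import Literature.IUT.LogVolume.GenuineSupportPrimesBound
import HarnessLib

/-!
# Branch C, the CONE binder `hvol` of `abc_of_S_v3` at `d_mod > 1`: the (U)-computable half FORCES an effective
# abc/Szpiro-type inequality on the `λ`-line — DATUM-FREE, IUT-FREE (the refute-direction half of the obstruction certificate)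

Record-only PROOF file (D-0012; 0 definitions, no new `Prop`) of the abc-iut cell, branch C «conditional verification»
(R2 S-chain seat abc-iut-s2-p5, TARGET #1 «hvol residue»; lineage abc-iut-S8 `LDHSlotResidue` / abc-iut-S7
`LDHSlotResiduePointPair` / abc-iut-c312-d1 plan/c312/STEPV-IND1-NOTE.md / abc-iut-S2 `GenuineLogThetaPoint` / abc-iut-L5-t7
`ThetaPartII.stub_thetaData`). TAKES NO SIDE on [IUTchIII] Cor. 3.12 or on [IUTchIV] Thm. 1.10. Sources: S. Mochizuki,
*IUT IV* [Mochizuki2012], proof of Thm. 1.10 Step (v), kurims pp. 27–28 («we may assume that `i†` is `j`» … «after passing to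
weighted averages, the operation of symmetrizing … does not affect the computation of the upper bound»), Cor. 2.2 (ii) proof
p. 46 ((P5): `𝕍^bad_mod` = the places of `F_mod` not dividing `2l` of bad multiplicative reduction); Dupuy–Hilado
[DupuyHilado2025] §3.3 (`ord_v(q_v) = −ord_v(j_E)`), §3.6 (`Pr(v) = n_v/[F_mod:ℚ]`), §4.7 ((Ind1) = permutations of the
tensor factors), §4.10–4.12 (`hull(U_Θ)`).

THE QUESTION (C-cert-2 «ABC_OF_S HYPS (7)» row (5)). The branch-C certificate `Conditional.abc_of_S_v3` (p430884) carries ONE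
cone binder of the S layer, `hvol` = the (U)-computable half (ii′) `Cor22.HullVolumeAtDatum P l B_III(P,l)` at every admissible
`(λ, l)`. It is PROVED at `d_mod = 1` / slot-constant data and below an explicit log-height threshold
(`LDHGenuineHullRegimeSlack`); abc-iut-S8 proved that it FORCES `slotResidue(T) ≤ B_III(P,l)` at every genuine datum, and
abc-iut-S7 wrote the pair consequence INSIDE the datum (places of the datum's `F_mod(E_F)`, `ThetaData.badPrimesMod T.D`).
THIS FILE removes the datum and every IUT object from that consequence, so that what `hvol` asserts at `d_mod ≥ 2` is ONE
closed Diophantine inequality on the `λ`-line, in the tree's own `λ`-line vocabulary (`Cor22.jInv`, `Cor22.jMod`,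
`F_mod = IntermediateField.adjoin ℚ {j(λ)} ⊆ F_tpd` as in `Cor22.dmod`, `placesOver`, `weight`, `ord`, `logNorm`, `localDegree`):

* tower bookkeeping (classical): `ord_mul_logNorm_div_localDegree_algebraMap` — the normalised local height
  `ord_w(y)·log N(w)/n_w` of `y ∈ F₀` is the same at every place `w | v` of an extension (`e_w = e(w|v)·e_v`, Mathlib
  `Ideal.ramificationIdx_tower`); `finBelow_eq_of_finBelow_eq_of_range_subset`, `weight_finBelow_eq_of_range_eq`,
  `ord_mul_logNorm_div_localDegree_finBelow_eq` — two subfields `A, B ⊆ K` with the SAME IMAGE cut out the same places of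
  `K`, with the same weights (weight descent, abc-iut `sum_filter_finBelow_weight`) and the same normalised local heights;
* `PointDict.range_algebraMap_adjoin_jInv_eq` — at a genuine datum `T` of `(P, l)` the point's `ℚ(j(λ)) ⊆ F_tpd` and the
  datum's `F_mod(E_F) = ℚ(j(E_F)) ⊆ F` have the same image in `F` (`T.j_eq`, `IntermediateField.adjoin_map`);
* **`PointDict.splitPair_le_of_hullVolumeAtDatum`** — `Cor22.HullVolumeAtDatum P l δ` + a genuine datum at `(P, l)` ⟹ for
  all places `v, w` of `ℚ(j(λ))` over one rational prime with `ord_v j(λ) < 0`, `v ∤ 2l` and (`ord_w j(λ) ≥ 0` ∨ `w | 2` ∨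
  `w | l`): `Pr(v)·Pr(w)·(l(l+1)/12)·((−ord_v j(λ))/(2l))·log N(v)/n_v ≤ δ` (the (P5) choice `T.isP5Choice` reads badness
  as «`ord(j) < 0` and `∤ 2l`»: semistability of `E_F`, `|j|_x ≤ 1` at good `x`);
* `PointDict.splitPair_vacuous_of_dmod_eq_one` — at `d_mod = 1` no such pair exists (one place over `p`);
* **`PointDict.splitPair_le_BIII_of_hvol`** — from the binder `hvol` of `abc_of_S_v3` VERBATIM: the same with
  `δ = B_III(P,l)` in the form `Pr(v)·Pr(w)·((l+1)/24)·(−ord_v j(λ))·log N(v)/n_v ≤ B_III(P,l)`, the datum supplied by the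
  PROVED (P7) `ThetaPartII.stub_thetaData`.

READING (nothing asserted about any point): at `d_mod ≥ 2` the cone binder `hvol` CONTAINS an effective abc/Szpiro-type
inequality, uniform over all admissible `λ` and primes `l` (no size link between `l` and the height is among `hvol`'s binders);
a kernel refutation of `hvol` must name an admissible `λ` violating it (an abc-violating configuration), a kernel proof of `hvol`
proves this open effective bound; the converse half («mixed part of `((l+1)/24)·log q^{∤{2,l}}(λ)` ≤ slack» ⟹ `hvol`) is
abc-iut-c312-d1's `hullVolumeAtDatum_BIII_of_logQAvoid_le`. This CERTIFIES the residue of TARGET #1 as Szpiro-type in the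
refute direction; it does not close it; no side taken on Cor. 3.12 / Thm. 1.10 / (U) vs (P); typed ≠ proved.
[cite: Mochizuki2012, IUTchIV Thm. 1.10 Step (v) p. 27–28] [cite: Mochizuki2012, IUTchIV Cor. 2.2 (ii) proof p. 46]
[cite: DupuyHilado2025, §3.3, §3.6, §4.7, §4.10–4.12] [cite: NeukirchANT1999, Ch. I §8 Prop. (8.2)]
[claim: Mochizuki2012, status: disputed] for every IUT quotation.
-/

noncomputable section

namespace Summit.ABC.IUTFork

open NumberField IsDedekindDomain Literature.IUT.LogVolume Literature.IUT.HodgeTheaters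
open Literature.NumberTheory.DiophantineGeometry.GenEll
open scoped Classical

/-! ## Tower bookkeeping: the normalised local height `ord_v(y)·log N(v)/n_v` does not see the field -/

section Tower

variable {F₀ K : Type} [Field F₀] [NumberField F₀] [Field K] [NumberField K] [Algebra F₀ K]

/-- `log N(v)/n_v = (log p_v)/e_v` (`N(v) = p_v^{f_v}`, `n_v = e_v·f_v`). [cite: NeukirchANT1999, Ch. I §8 Prop. (8.2)] -/
theorem logNorm_div_localDegree_eq_log_div_ramIdx (v : HeightOneSpectrum (𝓞 F₀)) :
    logNorm F₀ v / (localDegree F₀ v : ℝ) = Real.log (residueChar F₀ v) / (ramIdx F₀ v : ℝ) := by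
  rw [logNorm_eq, localDegree]
  have he : (ramIdx F₀ v : ℝ) ≠ 0 := by exact_mod_cast ramIdx_ne_zero F₀ v
  have hf : (resDeg F₀ v : ℝ) ≠ 0 := by exact_mod_cast resDeg_ne_zero F₀ v
  push_cast
  field_simp

/-- Transitivity of the absolute ramification index along `ℤ ⊆ 𝓞_{F₀} ⊆ 𝓞_K`: `e_w = e(w|v)·e_v` for `w | v`
(Mathlib `Ideal.ramificationIdx_tower`). [cite: NeukirchANT1999, Ch. I §8 Prop. (8.2)] -/
theorem ramIdx_eq_ramificationIdx'_mul_ramIdx_finBelow (w : HeightOneSpectrum (𝓞 K)) :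
    ramIdx K w = Ideal.ramificationIdx' (finBelow F₀ K w).asIdeal w.asIdeal * ramIdx F₀ (finBelow F₀ K w) := by
  rw [ramIdx_eq, ramIdx_eq,
    Ideal.ramificationIdx'_eq_ramificationIdx (finBelow F₀ K w).asIdeal w.asIdeal (finBelow F₀ K w).ne_bot,
    Ideal.ramificationIdx_tower (R := ℤ) (w.asIdeal.under (𝓞 F₀)) w.asIdeal, mul_comm]
  rfl

/-- **The normalised local height is extension-invariant**: for a place `w` of `K` over the place `v` of `F₀` and
`y ∈ F₀`, `ord_w(y)·log N(w)/n_w = ord_v(y)·log N(v)/n_v` (`ord_w = e(w|v)·ord_v`, `log N(w)/n_w = log p/e_w`,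
`e_w = e(w|v)·e_v`). [cite: NeukirchANT1999, Ch. I §8 Prop. (8.2)] -/
theorem ord_mul_logNorm_div_localDegree_algebraMap (w : HeightOneSpectrum (𝓞 K)) (y : F₀) :
    (ord K w (algebraMap F₀ K y) : ℝ) * logNorm K w / (localDegree K w : ℝ) =
      (ord F₀ (finBelow F₀ K w) y : ℝ) * logNorm F₀ (finBelow F₀ K w) / (localDegree F₀ (finBelow F₀ K w) : ℝ) := by
  rw [mul_div_assoc, mul_div_assoc, logNorm_div_localDegree_eq_log_div_ramIdx,
    logNorm_div_localDegree_eq_log_div_ramIdx, residueChar_finBelow, ord_algebraMap F₀ K w y,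
    ramIdx_eq_ramificationIdx'_mul_ramIdx_finBelow (F₀ := F₀) w]
  have he : (Ideal.ramificationIdx' (finBelow F₀ K w).asIdeal w.asIdeal : ℝ) ≠ 0 := by
    exact_mod_cast Ideal.IsDedekindDomain.ramificationIdx'_ne_zero_of_liesOver w.asIdeal (finBelow F₀ K w).ne_bot
  have he0 : (ramIdx F₀ (finBelow F₀ K w) : ℝ) ≠ 0 := by exact_mod_cast ramIdx_ne_zero F₀ _
  push_cast
  field_simp

end Tower

/-! ## Two base fields with the same image in `K` cut out the same places of `K` -/

section SameImage

variable {A B K : Type} [Field A] [NumberField A] [Field B] [NumberField B] [Field K] [NumberField K]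
  [Algebra A K] [Algebra B K]

omit [NumberField A] [NumberField B] [NumberField K] in
/-- If the image of `B` in `K` is contained in the image of `A`, then two places of `K` over the same place of `A` lie
over the same place of `B` (`w ∩ 𝓞_B` is read inside `w ∩ 𝓞_A`). [cite: NeukirchANT1999, Ch. I §8] -/
theorem finBelow_eq_of_finBelow_eq_of_range_subset
    (hBA : Set.range (algebraMap B K) ⊆ Set.range (algebraMap A K))
    {z x : HeightOneSpectrum (𝓞 K)} (h : finBelow A K z = finBelow A K x) :
    finBelow B K z = finBelow B K x := by
  apply HeightOneSpectrum.ext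
  ext b
  obtain ⟨a, ha⟩ := hBA ⟨(b : B), rfl⟩
  -- `a ∈ A` is integral, being the preimage of the integral element `b` under an injection
  have hbK : IsIntegral ℤ (algebraMap B K (b : B)) := (RingOfIntegers.isIntegral_coe b).algebraMap
  rw [← ha] at hbK
  have haint : IsIntegral ℤ a :=
    (isIntegral_algHom_iff (algebraMap A K).toIntAlgHom (algebraMap A K).injective).mp hbK
  set a' : 𝓞 A := ⟨a, haint⟩ with ha'
  have hab : algebraMap (𝓞 A) (𝓞 K) a' = algebraMap (𝓞 B) (𝓞 K) b := by
    apply RingOfIntegers.coe_injective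
    change algebraMap A K (a' : A) = algebraMap B K (b : B)
    exact ha
  change b ∈ (z.asIdeal.under (𝓞 B)) ↔ b ∈ (x.asIdeal.under (𝓞 B))
  rw [Ideal.mem_comap, Ideal.mem_comap, ← hab]
  change a' ∈ (finBelow A K z).asIdeal ↔ a' ∈ (finBelow A K x).asIdeal
  rw [h]

omit [NumberField A] [NumberField B] [NumberField K] in
/-- If `A` and `B` have the same image in `K`, the fibres of `V(K) → V(A)` and `V(K) → V(B)` coincide.
[cite: NeukirchANT1999, Ch. I §8] -/
theorem finBelow_eq_iff_of_range_eq (hAB : Set.range (algebraMap A K) = Set.range (algebraMap B K))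
    (z x : HeightOneSpectrum (𝓞 K)) : finBelow A K z = finBelow A K x ↔ finBelow B K z = finBelow B K x :=
  ⟨finBelow_eq_of_finBelow_eq_of_range_subset hAB.symm.subset, finBelow_eq_of_finBelow_eq_of_range_subset hAB.subset⟩

/-- **Same image, same weights**: if `A` and `B` have the same image in `K`, then for a place `x` of `K` over `p`,
`Pr_A(x ∩ A) = Pr_B(x ∩ B)` — both are the total `K`-weight of the common fibre (weight descent twice).
[cite: DupuyHilado2025, §3.6] -/
theorem weight_finBelow_eq_of_range_eq (hAB : Set.range (algebraMap A K) = Set.range (algebraMap B K))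
    {p : ℕ} [Fact p.Prime] (x : HeightOneSpectrum (𝓞 K)) (hx : x ∈ placesOver K p) :
    weight A (finBelow A K x) = weight B (finBelow B K x) := by
  rw [← sum_filter_finBelow_weight A K (finBelow A K x) (finBelow_mem_placesOver A K hx),
    ← sum_filter_finBelow_weight B K (finBelow B K x) (finBelow_mem_placesOver B K hx)]
  refine Finset.sum_congr ?_ fun _ _ => rfl
  ext z
  simp only [Finset.mem_filter, finBelow_eq_iff_of_range_eq hAB z x]

/-- Same image, same normalised local heights: for `a ∈ A`, `b ∈ B` with the same image in `K` and a place `x` of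
`K`, `ord_{x∩A}(a)·log N(x∩A)/n_{x∩A} = ord_{x∩B}(b)·log N(x∩B)/n_{x∩B}`. [cite: NeukirchANT1999, Ch. I §8 Prop. (8.2)] -/
theorem ord_mul_logNorm_div_localDegree_finBelow_eq {a : A} {b : B} (hab : algebraMap A K a = algebraMap B K b)
    (x : HeightOneSpectrum (𝓞 K)) :
    (ord A (finBelow A K x) a : ℝ) * logNorm A (finBelow A K x) / (localDegree A (finBelow A K x) : ℝ) =
      (ord B (finBelow B K x) b : ℝ) * logNorm B (finBelow B K x) / (localDegree B (finBelow B K x) : ℝ) := by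
  rw [← ord_mul_logNorm_div_localDegree_algebraMap x a, ← ord_mul_logNorm_div_localDegree_algebraMap x b, hab]

end SameImage

/-! ## At a genuine Θ-volume datum of `(P, l)`: `ℚ(j(λ)) ⊆ F_tpd` and `F_mod(E_F) ⊆ F` have the same image in `F` -/

namespace PointDict

variable {P : NFPoint} {l : ℕ}

/-- **`F_mod` seen from the point and from the datum agree inside `F`**: for a genuine Θ-volume datum `T` at `(P, l)`
(`j(E_F) = j(λ)` in `F`, abc-iut-S2's `T.j_eq`), the image of `ℚ(j(λ)) ⊆ F_tpd` under `F_tpd → F` IS the field of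
moduli `F_mod = ℚ(j(E_F)) ⊆ F` of the datum's curve (`IntermediateField.adjoin_map`).
[cite: Mochizuki2012, IUTchI Def. 3.1 (b) p. 61] [cite: Mochizuki2012, IUTchIV Cor. 2.2 (ii) proof p. 46] -/
theorem range_algebraMap_adjoin_jInv_eq (T : Cor22.ThetaVolumeDatumAt P l) :
    (letI := T.instFieldF; letI := T.instNumberFieldF; letI := T.instAlgebraF; letI := T.instIsElliptic
     Set.range ((algebraMap P.F T.F).comp
        (algebraMap ↥(IntermediateField.adjoin ℚ ({Cor22.jInv P.x} : Set P.F)) P.F)) =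
      Set.range (algebraMap ↥(fieldOfModuli T.E) T.F)) := by
  letI := T.instFieldF; letI := T.instNumberFieldF; letI := T.instAlgebraF; letI := T.instIsElliptic
  have h1 : Set.range (algebraMap ↥(fieldOfModuli T.E) T.F) = ((fieldOfModuli T.E : IntermediateField ℚ T.F) : Set T.F) :=
    Subtype.range_coe
  have h2 : Set.range ((algebraMap P.F T.F).comp (algebraMap ↥(IntermediateField.adjoin ℚ ({Cor22.jInv P.x} : Set P.F)) P.F)) =
      (algebraMap P.F T.F) '' ((IntermediateField.adjoin ℚ ({Cor22.jInv P.x} : Set P.F) : IntermediateField ℚ P.F) : Set P.F) := by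
    ext y
    simp only [Set.mem_range, Set.mem_image, RingHom.coe_comp, Function.comp_apply, SetLike.mem_coe]
    constructor
    · rintro ⟨z, rfl⟩
      exact ⟨(z : P.F), z.2, rfl⟩
    · rintro ⟨z, hz, rfl⟩
      exact ⟨⟨z, hz⟩, rfl⟩
  rw [h1, h2]
  have h3 : (algebraMap P.F T.F) '' ((IntermediateField.adjoin ℚ ({Cor22.jInv P.x} : Set P.F) : IntermediateField ℚ P.F) : Set P.F) =
      (((IntermediateField.adjoin ℚ ({Cor22.jInv P.x} : Set P.F)).map (algebraMap P.F T.F).toRatAlgHom : IntermediateField ℚ T.F) :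
        Set T.F) := by
    rw [IntermediateField.coe_map]
    rfl
  rw [h3, IntermediateField.adjoin_map, Set.image_singleton, RingHom.toRatAlgHom_apply, ← T.j_eq]
  rfl

/-- **The (U)-computable half at `(P, l)` FORCES the split-pair inequality on `j(λ)` — datum-free, IUT-free statement.**
`F_mod := ℚ(j(λ)) ⊆ F_tpd` (`IntermediateField.adjoin ℚ {j(λ)}`, as in `Cor22.dmod` / `Cor22.jMod P`); `v, w` places of `F_mod`
over the rational prime `p` with `ord_v j(λ) < 0`, `v ∤ 2`, `v ∤ l` (a (P5)-bad place) and `ord_w j(λ) ≥ 0` or `w | 2` or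
`w | l` (a place outside the (P5)-bad set). IF `Cor22.HullVolumeAtDatum P l δ` (conclusion of the cone binder `hvol` / the stubs
`stub_hullVolume`, `stub_hullRegime` of stmt-ABC-19678, there with `δ = B_III(P,l)`) and a genuine Θ-volume datum `T` exists at
`(P, l)`, THEN `Pr(v)·Pr(w)·(l(l+1)/12)·((−ord_v j(λ))/(2l))·log N(v)/n_v ≤ δ` (`Pr(u) = n_u/[F_mod:ℚ]`). PROOF: abc-iut-S7's
`PointDict.ordPair_le_of_hullVolumeAtDatum` (abc-iut-S8's forced slot residue) on the datum's `F_mod(E_F) ⊆ F`, transported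
along `range_algebraMap_adjoin_jInv_eq` (same image ⟹ same places, weights, normalised local heights through a place of `F`
above), with badness read through the (P5) choice `T.isP5Choice` (semistability of `E_F`; `|j|_x ≤ 1` at good `x`). EMPTY at
`d_mod = 1`; at `d_mod ≥ 2` an abc/Szpiro-type inequality no volume computation supplies. Nothing asserted about any point; no side
taken on [IUTchIII] Cor. 3.12. [cite: Mochizuki2012, IUTchIV Thm. 1.10 Step (v) p. 27–28]
[cite: Mochizuki2012, IUTchIV Cor. 2.2 (ii) proof p. 46] [cite: DupuyHilado2025, §3.3, §3.6, §4.7, §4.12]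
[claim: Mochizuki2012, status: disputed] -/
theorem splitPair_le_of_hullVolumeAtDatum {δ : ℝ} (h : Cor22.HullVolumeAtDatum P l δ)
    (T : Cor22.ThetaVolumeDatumAt P l) (p : ℕ) [Fact p.Prime]
    (v w : HeightOneSpectrum (𝓞 ↥(IntermediateField.adjoin ℚ ({Cor22.jInv P.x} : Set P.F))))
    (hv : v ∈ placesOver _ p) (hw : w ∈ placesOver _ p) (hvj : ord _ v (Cor22.jMod P) < 0)
    (hv2 : ((2 : ℕ) : 𝓞 _) ∉ v.asIdeal) (hvl : ((l : ℕ) : 𝓞 _) ∉ v.asIdeal)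
    (hwj : 0 ≤ ord _ w (Cor22.jMod P) ∨ ((2 : ℕ) : 𝓞 _) ∈ w.asIdeal ∨ ((l : ℕ) : 𝓞 _) ∈ w.asIdeal) :
    weight _ v * weight _ w * ((l : ℝ) * ((l : ℝ) + 1) / 12) *
      (((-ord _ v (Cor22.jMod P) : ℤ) : ℝ) / (2 * (l : ℝ)) * logNorm _ v / (localDegree _ v : ℝ)) ≤ δ := by
  letI := T.instFieldF; letI := T.instNumberFieldF; letI := T.instAlgebraF; letI := T.instFieldK
  letI := T.instNumberFieldK; letI := T.instAlgebraK; letI := T.instFieldFbar; letI := T.instAlgebraFbar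
  letI := T.instAlgebraKFbar; letI := T.instIsElliptic
  -- the two copies of `F_mod` inside `F`
  set Fm : Type := ↥(IntermediateField.adjoin ℚ ({Cor22.jInv P.x} : Set P.F)) with hFm
  letI : Algebra Fm T.F := ((algebraMap P.F T.F).comp (algebraMap Fm P.F)).toAlgebra
  have hrange : Set.range (algebraMap Fm T.F) = Set.range (algebraMap ↥(fieldOfModuli T.E) T.F) :=
    range_algebraMap_adjoin_jInv_eq T
  have hjj : algebraMap Fm T.F (Cor22.jMod P) = algebraMap ↥(fieldOfModuli T.E) T.F (ThetaData.jMod T.E) := by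
    change algebraMap P.F T.F (algebraMap Fm P.F (Cor22.jMod P)) = T.E.j
    rw [T.j_eq]
    rfl
  -- places `x | v`, `y | w` of `F` and their restrictions `v', w'` to `F_mod(E_F)`
  obtain ⟨x, hx⟩ := PlaceSection.exists_under_eq (F₀ := Fm) (K := T.F) v
  obtain ⟨y, hy⟩ := PlaceSection.exists_under_eq (F₀ := Fm) (K := T.F) w
  have hxv : finBelow Fm T.F x = v := HeightOneSpectrum.ext (by rw [← hx]; rfl)
  have hyw : finBelow Fm T.F y = w := HeightOneSpectrum.ext (by rw [← hy]; rfl)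
  have hxp : x ∈ placesOver T.F p := by
    rw [mem_placesOver_iff_residueChar] at hv ⊢
    rw [← residueChar_finBelow (F := Fm), hxv, hv]
  have hyp : y ∈ placesOver T.F p := by
    rw [mem_placesOver_iff_residueChar] at hw ⊢
    rw [← residueChar_finBelow (F := Fm), hyw, hw]
  set v' := finBelow ↥(fieldOfModuli T.E) T.F x with hv'
  set w' := finBelow ↥(fieldOfModuli T.E) T.F y with hw'
  have hv'p : v' ∈ placesOver ↥(fieldOfModuli T.E) p := finBelow_mem_placesOver _ T.F hxp
  have hw'p : w' ∈ placesOver ↥(fieldOfModuli T.E) p := finBelow_mem_placesOver _ T.F hyp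
  -- `v'` is a (P5)-bad prime of `F_mod(E_F)`: `x ∤ 2l` and `E_F` is multiplicative at `x` (semistable, `ord_x j < 0`)
  have hordx : ord T.F x T.E.j < 0 := by
    have h1 : ord Fm (finBelow Fm T.F x) (Cor22.jMod P) < 0 := by rw [hxv]; exact hvj
    rw [← Cor22.ord_algebraMap_neg_iff x (Cor22.jMod P), hjj] at h1
    exact h1
  have hmult : T.E.HasMultiplicativeReductionAt x := by
    refine (T.D.isSemistable x).resolve_left fun hgood => ?_
    have hle : x.valuation T.F T.E.j ≤ 1 := valuation_j_le_one_of_hasGoodReduction_localMinimalModel x T.E hgood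
    have h0 : 0 ≤ ord T.F x T.E.j := by
      unfold ord
      rw [neg_nonneg]
      by_cases hz : x.valuation T.F T.E.j = 0
      · simp [hz]
      · rw [← WithZero.log_one]
        exact (WithZero.log_le_log hz one_ne_zero).mpr hle
    omega
  have hx2l : ∀ q ∈ ({2, l} : Finset ℕ), ((q : ℕ) : 𝓞 T.F) ∉ x.asIdeal := by
    intro q hq hmem
    have hmem' : ((q : ℕ) : 𝓞 Fm) ∈ (finBelow Fm T.F x).asIdeal :=
      (Cor22.natCast_mem_asIdeal_finBelow_iff x q).mpr hmem
    rw [hxv] at hmem'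
    simp only [Finset.mem_insert, Finset.mem_singleton] at hq
    rcases hq with rfl | rfl
    · exact hv2 hmem'
    · exact hvl hmem'
  have hv'bad : v' ∈ ThetaData.badPrimesMod T.D := by
    have hVF : FinitePlace.mk x ∈ T.D.VFbad :=
      (T.isP5Choice (FinitePlace.mk x)).mpr (by rw [FinitePlace.maximalIdeal_mk]; exact ⟨hx2l, hmult⟩)
    have h1 := (ThetaData.mk_mem_VFbad_iff T.D x).mp hVF
    have he : HeightOneSpectrum.under (𝓞 ↥(fieldOfModuli T.E)) x = v' := HeightOneSpectrum.ext rfl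
    rwa [he] at h1
  -- `w'` is NOT a (P5)-bad prime: otherwise `y ∤ 2l` and `E_F` multiplicative at `y`, so `ord_w j(λ) < 0`, `w ∤ 2`, `w ∤ l`
  have hw'not : w' ∉ ThetaData.badPrimesMod T.D := by
    intro hbad
    have he : HeightOneSpectrum.under (𝓞 ↥(fieldOfModuli T.E)) y = w' := HeightOneSpectrum.ext rfl
    have hVF : FinitePlace.mk y ∈ T.D.VFbad := (ThetaData.mk_mem_VFbad_iff T.D y).mpr (by rw [he]; exact hbad)
    obtain ⟨hy2l, hmulty⟩ := (T.isP5Choice (FinitePlace.mk y)).mp hVF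
    rw [FinitePlace.maximalIdeal_mk] at hy2l hmulty
    have hordy : ord T.F y T.E.j < 0 := ThetaData.ord_j_neg_of_hasMultiplicativeReductionAt hmulty
    rcases hwj with hge | h2 | hl2
    · have h1 : ord Fm (finBelow Fm T.F y) (Cor22.jMod P) < 0 := by
        rw [← Cor22.ord_algebraMap_neg_iff y (Cor22.jMod P), hjj]
        exact hordy
      rw [hyw] at h1
      exact absurd h1 (not_lt.mpr hge)
    · exact hy2l 2 (by simp) ((Cor22.natCast_mem_asIdeal_finBelow_iff y 2).mp (by rw [hyw]; exact h2))
    · exact hy2l l (by simp) ((Cor22.natCast_mem_asIdeal_finBelow_iff y l).mp (by rw [hyw]; exact hl2))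
  -- abc-iut-S7's pair inequality at `(v', w')`, read on the DATUM's `F_mod(E_F)`
  have hS7 : weight ↥(fieldOfModuli T.E) v' * weight ↥(fieldOfModuli T.E) w' * ((l : ℝ) * ((l : ℝ) + 1) / 12) *
      (((-ord ↥(fieldOfModuli T.E) v' (ThetaData.jMod T.E) : ℤ) : ℝ) / (2 * (l : ℝ)) *
        logNorm ↥(fieldOfModuli T.E) v' / (localDegree ↥(fieldOfModuli T.E) v' : ℝ)) ≤ δ :=
    ordPair_le_of_hullVolumeAtDatum h T p ⟨v', hv'p⟩ ⟨w', hw'p⟩ hv'bad hw'not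
  -- transport the weights and the normalised local height to the POINT's `F_mod = ℚ(j(λ))`
  have hwv : weight ↥(fieldOfModuli T.E) v' = weight Fm v := by
    rw [← hxv]; exact (weight_finBelow_eq_of_range_eq hrange x hxp).symm
  have hww : weight ↥(fieldOfModuli T.E) w' = weight Fm w := by
    rw [← hyw]; exact (weight_finBelow_eq_of_range_eq hrange y hyp).symm
  have hμ : ((-ord ↥(fieldOfModuli T.E) v' (ThetaData.jMod T.E) : ℤ) : ℝ) / (2 * (l : ℝ)) *
        logNorm ↥(fieldOfModuli T.E) v' / (localDegree ↥(fieldOfModuli T.E) v' : ℝ) =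
      ((-ord Fm v (Cor22.jMod P) : ℤ) : ℝ) / (2 * (l : ℝ)) * logNorm Fm v / (localDegree Fm v : ℝ) := by
    have key := ord_mul_logNorm_div_localDegree_finBelow_eq (A := Fm) (B := ↥(fieldOfModuli T.E)) hjj x
    rw [hxv] at key
    have e : ∀ a L n : ℝ, -a / (2 * (l : ℝ)) * L / n = -(1 / (2 * (l : ℝ))) * (a * L / n) := fun _ _ _ => by ring
    push_cast
    rw [e, e, key]
  rw [hwv, hww, hμ] at hS7
  exact hS7

/-- **At `d_mod = 1` the split-pair inequality is EMPTY** (the «d = 1 cut»): if `[ℚ(j(λ)):ℚ] = 1` there is ONE place of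
`F_mod` over each rational prime, so no pair `(v, w)` over `p` with `v` (P5)-bad (`ord_v j(λ) < 0`, `v ∤ 2l`) and `w`
outside the (P5)-bad set exists — consistent with the UNCONDITIONAL (U)-volume body at `d_mod = 1`
(`PilotData.slotResidue_eq_zero_of_card_le_one`, abc-iut-S3/S7/c312-8's degree-one line). Pure place counting
(`Σ_{u|p} n_u = [F_mod:ℚ]`). [cite: DupuyHilado2025, §3.6] -/
theorem splitPair_vacuous_of_dmod_eq_one (hd : Cor22.dmod P = 1) (p : ℕ) [Fact p.Prime]
    (v w : HeightOneSpectrum (𝓞 ↥(IntermediateField.adjoin ℚ ({Cor22.jInv P.x} : Set P.F))))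
    (hv : v ∈ placesOver _ p) (hw : w ∈ placesOver _ p) (hvj : ord _ v (Cor22.jMod P) < 0)
    (hv2 : ((2 : ℕ) : 𝓞 _) ∉ v.asIdeal) (hvl : ((l : ℕ) : 𝓞 _) ∉ v.asIdeal) :
    ¬ (0 ≤ ord _ w (Cor22.jMod P) ∨ ((2 : ℕ) : 𝓞 _) ∈ w.asIdeal ∨ ((l : ℕ) : 𝓞 _) ∈ w.asIdeal) := by
  set Fm : Type := ↥(IntermediateField.adjoin ℚ ({Cor22.jInv P.x} : Set P.F)) with hFm
  -- one place over `p`: `Σ_{u|p} n_u = [F_mod:ℚ] = 1` with every `n_u ≥ 1`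
  have hsum : ∑ u ∈ placesOver Fm p, localDegree Fm u = 1 := by rw [sum_localDegree Fm p]; exact hd
  have hcard : (placesOver Fm p).card ≤ 1 := by
    have h1 : (placesOver Fm p).card • 1 ≤ ∑ u ∈ placesOver Fm p, localDegree Fm u :=
      Finset.card_nsmul_le_sum _ _ 1 fun u _ => localDegree_pos Fm u
    rw [hsum, smul_eq_mul, mul_one] at h1
    exact h1
  have hvw : v = w := Finset.card_le_one.mp hcard v hv w hw
  subst hvw
  rintro (hge | h2 | hl2)
  · exact absurd hvj (not_lt.mpr hge)
  · exact hv2 h2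
  · exact hvl hl2

/-- **THE CONE BINDER `hvol` OF `abc_of_S_v3` (p430884) IMPLIES AN EFFECTIVE abc/SZPIRO-TYPE INEQUALITY ON THE `λ`-LINE —
the refute-direction half of the Szpiro-type obstruction certificate, DATUM-FREE and IUT-FREE.** Assume `hvol` VERBATIM (the
(U)-computable half (ii′) `Cor22.HullVolumeAtDatum P l B_III(P,l)` at every `λ ∈ U_X` minimally presented, prime `l ≥ 5`,
«admits a core», (P2), (P5), (P6); `d* = 2^12·3^3·5·d_mod`). THEN for every such `(λ, l)`, every rational prime `p` and places
`v, w` of `F_mod = ℚ(j(λ))` over `p` with `ord_v j(λ) < 0`, `v ∤ 2`, `v ∤ l` and (`ord_w j(λ) ≥ 0` or `w | 2` or `w | l`):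
`Pr(v)·Pr(w)·((l+1)/24)·(−ord_v j(λ))·log N(v)/n_v ≤ B_III(λ,l) = (l+1)/4·{(1+12d_mod/l)(log-diff + log-cond) + 2 log l + 52 +
(20/3) log(d*l) π(d*l)}` — the `Pr`-weighted local height of `j(λ)` at ONE split multiplicative place is bounded by print's
constant. The datum is the PROVED (P7) `ThetaPartII.stub_thetaData` (abc-iut-L5-t7); nothing else is assumed. READING (nothing
asserted about any point): uniform over all admissible `λ` of all degrees (EMPTY at `d_mod = 1`) and all admissible `l` (no size
link between `l` and the height among `hvol`'s binders), this is an effective abc/Szpiro-type inequality: a kernel REFUTATION of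
`hvol` must exhibit an admissible `λ` violating it (split-quality above `24(1+12d_mod/l)/(Pr(v)Pr(w))` at log-height
`≳ 40·log(d*l)·π(d*l)`, an abc-violating configuration), a kernel PROOF of `hvol` proves it for all of them. No side taken on
[IUTchIII] Cor. 3.12 / [IUTchIV] Thm. 1.10; typed ≠ proved. [cite: Mochizuki2012, IUTchIV Thm. 1.10 Step (v) p. 27–28]
[cite: Mochizuki2012, IUTchIV Cor. 2.2 (ii) proof p. 46] [cite: DupuyHilado2025, §3.3, §3.6, §4.7, §4.12]
[claim: Mochizuki2012, status: disputed] -/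
theorem splitPair_le_BIII_of_hvol
    (hvol : ∀ P₀ : NFPoint, P₀ ∈ UP → ∀ l : ℕ, l.Prime → 5 ≤ l →
      Cor22.AdmitsCore P₀ → Cor22.CondP2 P₀ l → Cor22.CondP5 P₀ l → Cor22.CondP6 P₀ l →
        Cor22.HullVolumeAtDatum P₀ l (((l : ℝ) + 1) / 4 *
          ((1 + 12 * (Cor22.dmod P₀ : ℝ) / l) * (P₀.logDiff + Cor22.logCondAvoid P₀ {2, l})
            + 2 * Real.log l + 52
            + 20 / 3 * Real.log (((2 ^ 12 * 3 ^ 3 * 5 * Cor22.dmod P₀ : ℕ) : ℝ) * (l : ℝ))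
              * (Nat.primeCounting (2 ^ 12 * 3 ^ 3 * 5 * Cor22.dmod P₀ * l) : ℝ))))
    (hP : P ∈ UP) (hl : l.Prime) (h5 : 5 ≤ l) (hc : Cor22.AdmitsCore P) (hP2 : Cor22.CondP2 P l)
    (hP5 : Cor22.CondP5 P l) (hP6 : Cor22.CondP6 P l) (p : ℕ) [Fact p.Prime]
    (v w : HeightOneSpectrum (𝓞 ↥(IntermediateField.adjoin ℚ ({Cor22.jInv P.x} : Set P.F))))
    (hv : v ∈ placesOver _ p) (hw : w ∈ placesOver _ p) (hvj : ord _ v (Cor22.jMod P) < 0)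
    (hv2 : ((2 : ℕ) : 𝓞 _) ∉ v.asIdeal) (hvl : ((l : ℕ) : 𝓞 _) ∉ v.asIdeal)
    (hwj : 0 ≤ ord _ w (Cor22.jMod P) ∨ ((2 : ℕ) : 𝓞 _) ∈ w.asIdeal ∨ ((l : ℕ) : 𝓞 _) ∈ w.asIdeal) :
    weight _ v * weight _ w * (((l : ℝ) + 1) / 24) *
        (((-ord _ v (Cor22.jMod P) : ℤ) : ℝ) * logNorm _ v / (localDegree _ v : ℝ)) ≤
      ((l : ℝ) + 1) / 4 *
        ((1 + 12 * (Cor22.dmod P : ℝ) / l) * (P.logDiff + Cor22.logCondAvoid P {2, l})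
          + 2 * Real.log l + 52
          + 20 / 3 * Real.log (((2 ^ 12 * 3 ^ 3 * 5 * Cor22.dmod P : ℕ) : ℝ) * (l : ℝ))
            * (Nat.primeCounting (2 ^ 12 * 3 ^ 3 * 5 * Cor22.dmod P * l) : ℝ)) := by
  obtain ⟨T⟩ := Summit.ABC.ABC.Theorems.ThetaPartII.stub_thetaData P hP l hl h5 hc hP2 hP5 hP6
  have h := splitPair_le_of_hullVolumeAtDatum (hvol P hP l hl h5 hc hP2 hP5 hP6) T p v w hv hw hvj hv2 hvl hwj
  have hl0 : (l : ℝ) ≠ 0 := by exact_mod_cast hl.ne_zero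
  have key : (l : ℝ) * ((l : ℝ) + 1) / 12 * (1 / (2 * (l : ℝ))) = ((l : ℝ) + 1) / 24 := by
    field_simp
    ring
  refine le_trans (le_of_eq ?_) h
  rw [← key]
  ring

end PointDict

end Summit.ABC.IUTFork

end
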